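import Summits.RiemannHypothesis.Statement
import Summits.RiemannHypothesis.RiemannHypothesis.Theses.RuelleBand
import Summits.RiemannHypothesis.RiemannHypothesis.Theorems.Splittings.PairCorrelationOffLineDensity
import Literature.NumberTheory.DiophantineGeometry.NamedHypothesesProofs
import Literature.NumberTheory.LFunctions.ZetaArgVariation
import Literature.NumberTheory.LFunctions.ZeroDensityThirtyThirteenths
import Literature.NumberTheory.LFunctions.ZeroDensityInghamHuxley
import Literature.NumberTheory.LFunctions.ZeroStatisticsGUEProofs

/-!
# Splittings — «SPARSE ∧ RIGID»: the X4 conditional-complements schema, the ladder edge FOZ ⊂ o(N),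
# and the 100 % hypothesis (cell rh-split, CANDIDATES rows C18/C19; zero-definition raw form)

Cell rh-split (brief sha16 f79c5f09d8bcb036), cross seat rh-splitx-theory-2 g0, scratch
`HOME/rh-splitx-theory-2/T2SparseRigid.lean` FINAL sha16 bdd22f3c0c6320e2 (244 l; v1 5e28b3a2acf04aaa ⊂ v2.1 verbatim),
`CANDIDATES-theory2.md` §1 / lead's `CANDIDATES.md` rows C18 («SPARSE ∧ RIGID») and C19.  Referee rh-split-ref g2
CONTENT PASS 2026-08-27T01:09Z on v1 with the instruction «spell out the defs `offLineCount` (duplicate of the tree sum),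
`OffLineDensityZero`, `Rigid`» (v2.1 adds a fourth, `OnLineDensityOne`, spelled out likewise); LABEL (referee 01:09Z /
lead 01:11Z): the rows «S ∧ Rigid S ⟹ RH» are RELABELLING BY CONSTRUCTION (`Rigid S ⟺ RH ∨ ¬S`); the CONTENT is the
RH-free ladder edge FOZ ⟹ o(N) and the collapse at proved rungs; MAP file, no survivor created; the by-product
`onLineDensityOne_of_pairCorrelation` is CONDITIONAL-on-PCC.  Filed by rh-split-typer-2 g3 (G7 of the lead's typer queue,
01:01Z/01:11Z; CLAIM 01:16Z), proofs verbatim up to the def spell-out.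

## Dictionary (scratch def ↦ spelled-out term used below)

* `offLineCount T` ↦ `(∑ ρ ∈ ((zetaZeroBox_finite 0 T).toFinset).filter (fun ρ ↦ ρ.re ≠ 1 / 2), riemannZetaZeroOrder ρ : ℤ)`
  — the off-line zeros of the box `0 < Im ρ ≤ T` counted WITH MULTIPLICITY, exactly the sum of the tree file
  `Splittings.PairCorrelationOffLineDensity` (`offLineCount_nonneg`, `offLine_density_tendsto_zero_of_pairCorrelation`);
* `OffLineDensityZero` («SPARSE(o(N))», the zero side of the 100 % hypothesis) ↦
  `Tendsto (fun T : ℝ ↦ ((∑ …off-line sum… : ℤ) : ℝ) / zetaZeroCount T) atTop (𝓝 0)` — verbatim the conclusion of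
  `offLine_density_tendsto_zero_of_pairCorrelation`;
* `Rigid S` (the FIAT rigidity complement «if the off-line configuration is `S`-sparse then it is empty») ↦ `S → RiemannHypothesis`;
* `OnLineDensityOne` (the 100 % hypothesis in limit form) ↦ `Tendsto (fun T : ℝ ↦ (criticalZeroCount T : ℝ) / zetaZeroCount T) atTop (𝓝 1)`.

Three scratch declarations are NOT re-filed because, once spelled out, they are the tree verbatim or empty:
`offLineCount_nonneg'` (= tree `offLineCount_nonneg`), `offLineDensityZero_of_pairCorrelation`
(= tree `offLine_density_tendsto_zero_of_pairCorrelation`), `rigid_cofinite_iff` (`Iff.rfl` of a term with itself).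
`Rigid.anti` is renamed `rigid_anti` (no `Rigid` namespace remains).

## Content

* the SCHEMA and its propositional bookkeeping for an arbitrary sparseness statement `S : Prop`:
  `rh_of_sparse_of_rigid`, `rigid_of_rh`, `rigid_iff_rh_or_not` (`(S → RH) ↔ RH ∨ ¬S` — the exact sense in which every
  X4 row is a relabelling), `rigid_iff_rh_of_proved` (COLLAPSE at a proved rung), `rigid_anti` (ladder monotonicity),
  and the COMPLEMENTARY-SIGNATURES lemma `not_rigid_of_sparse_of_not_rh` / `rigid_of_not_sparse`;
* row H4: `rh_of_pairCorrelation_of_rigid : MontgomeryPairCorrelation → (o(N) → RH) → RiemannHypothesis`;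
* the LADDER EDGE `offLineDensityZero_of_cofiniteCriticalLine : CofiniteCriticalLine → o(N)` (RH-free kernel theorem:
  under FOZ the off-line count is bounded by the total multiplicity of the finite off-line set, and `N(T) → ∞`), whence
  `rigid_cofinite_of_rigid_densityZero` (the o(N)-rigidity complement implies x-wuc's FOZ-bridge «FOZ → RH»);
* row H6: `zetaZeroCount_eq_offLineCount_add_criticalZeroCount` (`N(T) = N_off(T) + N₀(T)` with multiplicity, RH-free),
  `offLineDensityZero_iff_onLineDensityOne` (SPARSE(o(N)) ⟺ «N₀/N → 1»), `rh_of_onLineDensityOne_of_rigid`, and the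
  by-product `onLineDensityOne_of_pairCorrelation` (tree PCC ⟹ 100 % of the zeros on the line; CONDITIONAL-on-PCC —
  zd-bridge g4's p475996 in N₀-currency);
* COLLAPSE instances at the PROVED rungs Guth–Maynard 30/13 (`zeroDensity_thirty_thirteenths_holds`), Ingham
  (`zeroDensity_ingham_holds`), Huxley (`Ivic1985_theorem11_1_huxley_holds`) — `(rung → RH) ↔ RH` verbatim — versus the
  unproved rung `DensityHypothesis` (`↔ RH ∨ ¬DH`).

Typer replay (rh-split-typer-2 g3): scratch bdd22f3c0c6320e2 farm rc 0 / 0 warnings / 0 sorry, `#print axioms` standard on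
`onLineDensityOne_of_pairCorrelation`; this carved file re-checked rc 0 / 0 warnings; axioms [propext, Classical.choice,
Quot.sound] on `offLineDensityZero_of_cofiniteCriticalLine`, `zetaZeroCount_eq_offLineCount_add_criticalZeroCount`,
`rigid_thirtyThirteenths_iff_rh` (no F1, no `native_decide`).

## Addendum G7c (appended; theory-2 `T2ComplementsExtra.lean` v2 sha16 3fbd2616541cd346, zero-def carve)

* row H5: `offLineDensityZero_of_gue` / `rh_of_gue_of_rigid` — the GUE hypothesis (tree `GUEHypothesis`, all levels)
  gives Montgomery's pair correlation (`montgomeryPairCorrelation_of_gueHypothesisAt_one`), hence SPARSE(o(N)), hence RH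
  under the fiat complement (CONDITIONAL bookkeeping, both conjuncts open);
* PA-3 in PLANT-WORLD form (pure logic), with the scratch def `FiatRigid Sparse NoOff W` spelled `Sparse W → NoOff W`:
  over ANY type of model worlds and ANY predicates `Sparse NoOff : World → Prop`, in a world with an off-line zero the
  fiat complement holds iff the sparseness conjunct fails (`fiatRigid_iff_not_sparse`), so EXACTLY ONE of the two
  conjuncts fails (`exactly_one_conjunct_fails`); `split_fails_in_every_nonRH_world`, `fiatRigid_of_noOff`;
* row H2 (citation only, no declaration — it would add a build-cone edge for a one-line composition): DH is blind to
  FOZ-worlds by the tree theorem `BombieriFozNoDep.densityHypothesis_of_cofiniteCriticalLine` (p457372 = theory-2's §C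
  verbatim), so `rigid_anti densityHypothesis_of_cofiniteCriticalLine : (DensityHypothesis → RH) → (CofiniteCriticalLine → RH)`:
  the DH row's complement is at least Bombieri's target FOZ ⟹ RH.

HONEST LABEL: «SPLITTING SEARCH over kernel-typed RH-EQUIVALENCES; a splitting A ∧ B ⟹ RH is CONDITIONAL bookkeeping
unless A and B are both proved; nothing here bears on the truth of RH.»
-/

set_option linter.dupNamespace false

noncomputable section

namespace Summit.RiemannHypothesis.RiemannHypothesis.Theorems.Splittings.SparseRigid

open Filter Topology Complex
open Literature.NumberTheory.DiophantineGeometry Literature.NumberTheory.LFunctions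
open Summit.RiemannHypothesis.RiemannHypothesis.Theses.RuelleBand
open Summit.RiemannHypothesis.RiemannHypothesis.Theorems.Splittings.PairCorrelationOffLineDensity

/-! ## The schema and its propositional bookkeeping (`Rigid S` spelled `S → RiemannHypothesis`) -/

/-- THE SCHEMA of every X4 row: a sparseness statement `S` together with its fiat rigidity complement
`S → RiemannHypothesis` gives RH (modus ponens — the exact sense in which the row is bookkeeping).
[new-but-trivial; rh-split theory-2 C18] -/
theorem rh_of_sparse_of_rigid {S : Prop} (hA : S) (hB : S → RiemannHypothesis) : RiemannHypothesis := hB hA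

/-- The fiat complement is RH-implied (vacuously). [new-but-trivial; rh-split theory-2 C18] -/
theorem rigid_of_rh {S : Prop} (h : RiemannHypothesis) : S → RiemannHypothesis := fun _ ↦ h

/-- `S → RH` is weaker than RH by exactly the unprovedness of `S`: `(S → RH) ↔ RH ∨ ¬S` — the RELABELLING label
of the X4 rows in propositional form. [new-but-trivial; rh-split theory-2 C18] -/
theorem rigid_iff_rh_or_not (S : Prop) : (S → RiemannHypothesis) ↔ RiemannHypothesis ∨ ¬ S := by
  tauto

/-- COLLAPSE: from a PROVED sparseness rung the rigidity complement is RH itself.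
[new-but-trivial; rh-split theory-2 C18, footprint lemma F3(iii)] -/
theorem rigid_iff_rh_of_proved {S : Prop} (hS : S) : (S → RiemannHypothesis) ↔ RiemannHypothesis :=
  ⟨fun h ↦ h hS, fun h _ ↦ h⟩

/-- LADDER MONOTONICITY: a larger sparseness class has a stronger rigidity complement.
[new-but-trivial; rh-split theory-2 C18] -/
theorem rigid_anti {S₁ S₂ : Prop} (h : S₁ → S₂) :
    (S₂ → RiemannHypothesis) → (S₁ → RiemannHypothesis) := fun h₂ h₁ ↦ h₂ (h h₁)

/-- COMPLEMENTARY SIGNATURES (i): in an `S`-sparse world where RH fails, the complement FAILS (it detects).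
[new-but-trivial; rh-split theory-2 PA-3] -/
theorem not_rigid_of_sparse_of_not_rh {S : Prop} (hS : S) (hn : ¬ RiemannHypothesis) :
    ¬ (S → RiemannHypothesis) :=
  fun h ↦ hn (h hS)

/-- COMPLEMENTARY SIGNATURES (ii): in a non-`S`-sparse world the complement HOLDS vacuously (it is blind).
[new-but-trivial; rh-split theory-2 PA-3] -/
theorem rigid_of_not_sparse {S : Prop} (hS : ¬ S) : S → RiemannHypothesis := fun h ↦ (hS h).elim

/-! ## Row H4 of the X4 table: PCC ∧ RIGID(o(N)) ⟹ RH -/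

/-- ROW H4 (CONDITIONAL bookkeeping): Montgomery's pair correlation conjecture (tree `MontgomeryPairCorrelation`)
together with the fiat complement «density-zero off-line set ⟹ empty» gives RH — via the tree's
`offLine_density_tendsto_zero_of_pairCorrelation` (p475996). [new-combination; rh-split theory-2 C18 row H4] -/
theorem rh_of_pairCorrelation_of_rigid (hP : MontgomeryPairCorrelation)
    (hR : Tendsto (fun T : ℝ ↦ ((∑ ρ ∈ ((zetaZeroBox_finite 0 T).toFinset).filter (fun ρ ↦ ρ.re ≠ 1 / 2), riemannZetaZeroOrder ρ : ℤ) : ℝ) / zetaZeroCount T) atTop (𝓝 0) → RiemannHypothesis) :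
    RiemannHypothesis :=
  hR (offLine_density_tendsto_zero_of_pairCorrelation hP)

/-! ## The ladder edge FOZ ⊂ o(N) (RH-free) -/

/-- Every off-line zero of the box `0 < Im ρ ≤ T` lies in the off-line zero set of the critical strip whose
finiteness is `CofiniteCriticalLine` (FOZ). [folklore] -/
theorem mem_offLineSet_of_mem_filter {T : ℝ} {ρ : ℂ}
    (hρ : ρ ∈ ((zetaZeroBox_finite 0 T).toFinset).filter (fun ρ ↦ ρ.re ≠ 1 / 2)) :
    ρ ∈ {s : ℂ | riemannZeta s = 0 ∧ 0 < s.re ∧ s.re < 1 ∧ s.re ≠ 1 / 2} := by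
  classical
  rcases Finset.mem_filter.1 hρ with ⟨hbox, hne⟩
  have hb : ρ ∈ zetaZeroBox 0 T := (Set.Finite.mem_toFinset _).1 hbox
  rcases hb with ⟨hz, _, hre1, him, _⟩
  refine ⟨hz, re_pos_of_riemannZeta_eq_zero hz (ne_of_gt him), ?_, hne⟩
  rcases hre1.lt_or_eq with h | h
  · exact h
  · exact absurd hz (riemannZeta_ne_zero_of_one_le_re (le_of_eq h.symm))

/-- Under FOZ the off-line count (with multiplicity) is UNIFORMLY BOUNDED in `T` — by the total multiplicity of
the finite off-line set. [folklore; RH-free] -/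
theorem offLineCount_le_of_cofiniteCriticalLine (h : CofiniteCriticalLine) :
    ∃ M : ℤ, ∀ T : ℝ,
      (∑ ρ ∈ ((zetaZeroBox_finite 0 T).toFinset).filter (fun ρ ↦ ρ.re ≠ 1 / 2), riemannZetaZeroOrder ρ : ℤ) ≤ M := by
  classical
  refine ⟨∑ ρ ∈ h.toFinset, riemannZetaZeroOrder ρ, fun T ↦ ?_⟩
  refine Finset.sum_le_sum_of_subset_of_nonneg (fun ρ hρ ↦ ?_) (fun ρ hρ _ ↦ ?_)
  · exact (Set.Finite.mem_toFinset h).2 (mem_offLineSet_of_mem_filter hρ)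
  · have hz : riemannZeta ρ = 0 := ((Set.Finite.mem_toFinset h).1 hρ).1
    exact riemannZetaZeroOrder_nonneg (ne_one_of_riemannZeta_eq_zero hz)

/-- LADDER EDGE (RH-free): finitely many off-line zeros ⟹ the off-line zeros have DENSITY ZERO
(`N_off(T)/N(T) → 0`), since `N_off` is bounded and `N(T) → ∞` (`tendsto_zetaZeroCount_atTop_holds`).
[folklore; rh-split theory-2 C18 ladder edge FOZ ⊂ o(N)] -/
theorem offLineDensityZero_of_cofiniteCriticalLine (h : CofiniteCriticalLine) :
    Tendsto (fun T : ℝ ↦ ((∑ ρ ∈ ((zetaZeroBox_finite 0 T).toFinset).filter (fun ρ ↦ ρ.re ≠ 1 / 2), riemannZetaZeroOrder ρ : ℤ) : ℝ) / zetaZeroCount T) atTop (𝓝 0) := by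
  obtain ⟨M, hM⟩ := offLineCount_le_of_cofiniteCriticalLine h
  have hN : Tendsto (fun T : ℝ ↦ (zetaZeroCount T : ℝ)) atTop atTop :=
    tendsto_natCast_atTop_atTop.comp tendsto_zetaZeroCount_atTop_holds
  have hup : Tendsto (fun T : ℝ ↦ (M : ℝ) / (zetaZeroCount T : ℝ)) atTop (𝓝 0) :=
    tendsto_const_nhds.div_atTop hN
  refine tendsto_of_tendsto_of_tendsto_of_le_of_le tendsto_const_nhds hup (fun T ↦ ?_) (fun T ↦ ?_)
  · exact div_nonneg (Int.cast_nonneg (offLineCount_nonneg T)) (Nat.cast_nonneg _)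
  · exact div_le_div_of_nonneg_right (Int.cast_le.mpr (hM T)) (Nat.cast_nonneg _)

/-- The o(N)-rigidity complement implies the FOZ-bridge «FOZ → RH» (x-wuc): ladder monotonicity along the
edge FOZ ⊂ o(N). [new-combination; rh-split theory-2 C18] -/
theorem rigid_cofinite_of_rigid_densityZero
    (h : Tendsto (fun T : ℝ ↦ ((∑ ρ ∈ ((zetaZeroBox_finite 0 T).toFinset).filter (fun ρ ↦ ρ.re ≠ 1 / 2), riemannZetaZeroOrder ρ : ℤ) : ℝ) / zetaZeroCount T) atTop (𝓝 0) → RiemannHypothesis) :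
    CofiniteCriticalLine → RiemannHypothesis :=
  rigid_anti offLineDensityZero_of_cofiniteCriticalLine h

/-! ## Row H6 of the X4 table: the 100 % hypothesis `N₀(T)/N(T) → 1` certifies SPARSE(o(N))

Bookkeeping `N(T) = N_off(T) + N₀(T)` with multiplicity, so «N₀/N → 1» ⟺ «N_off/N → 0». -/

/-- `N(T) = N_off(T) + N₀(T)`: the zeros of the box `0 < Im ρ ≤ T` with multiplicity split into the off-line ones
(`Re ρ ≠ 1/2`) and the critical ones (`criticalZeroCount`). RH-free. [folklore] -/
theorem zetaZeroCount_eq_offLineCount_add_criticalZeroCount (T : ℝ) :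
    (zetaZeroCount T : ℤ) =
      (∑ ρ ∈ ((zetaZeroBox_finite 0 T).toFinset).filter (fun ρ ↦ ρ.re ≠ 1 / 2), riemannZetaZeroOrder ρ : ℤ)
        + (criticalZeroCount T : ℤ) := by
  classical
  have hA : (zetaZeroBox 0 T).Finite := zetaZeroBox_finite 0 T
  have hC : {ρ ∈ zetaZeroBox (1 / 2) T | ρ.re = 1 / 2}.Finite :=
    (zetaZeroBox_finite _ _).subset (Set.sep_subset _ _)
  have hposA : ∀ ρ ∈ hA.toFinset, 0 ≤ riemannZetaZeroOrder ρ := fun ρ hρ ↦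
    (riemannZetaZeroOrder_pos_of_mem_zetaZeroBox ((Set.Finite.mem_toFinset hA).1 hρ)).le
  have hsumA : 0 ≤ ∑ᶠ ρ ∈ zetaZeroBox 0 T, riemannZetaZeroOrder ρ := by
    rw [finsum_mem_eq_finite_toFinset_sum _ hA]; exact Finset.sum_nonneg hposA
  have hsumC : 0 ≤ ∑ᶠ ρ ∈ {ρ ∈ zetaZeroBox (1 / 2) T | ρ.re = 1 / 2}, riemannZetaZeroOrder ρ := by
    rw [finsum_mem_eq_finite_toFinset_sum _ hC]
    exact Finset.sum_nonneg fun ρ hρ ↦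
      (riemannZetaZeroOrder_pos_of_mem_zetaZeroBox
        (criticalZeroSet_subset_zetaZeroBox T ((Set.Finite.mem_toFinset hC).1 hρ))).le
  have hfilter : hA.toFinset.filter (fun ρ ↦ ρ.re = 1 / 2) = hC.toFinset := by
    ext ρ
    simp only [Finset.mem_filter, Set.Finite.mem_toFinset, Set.mem_setOf_eq]
    constructor
    · rintro ⟨⟨h0, _, h2, h3, h4⟩, hre⟩
      exact ⟨⟨h0, hre.ge, h2, h3, h4⟩, hre⟩
    · rintro ⟨hρ, hre⟩
      exact ⟨criticalZeroSet_subset_zetaZeroBox T ⟨hρ, hre⟩, hre⟩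
  unfold zetaZeroCount zetaZeroCountRe criticalZeroCount
  rw [Int.toNat_of_nonneg hsumA, Int.toNat_of_nonneg hsumC,
    finsum_mem_eq_finite_toFinset_sum _ hA, finsum_mem_eq_finite_toFinset_sum _ hC, ← hfilter,
    ← Finset.sum_filter_add_sum_filter_not hA.toFinset (fun ρ ↦ ρ.re = 1 / 2)]
  simp only [add_comm]

/-- Eventually `N(T) > 0`, so the two densities are complementary: `N_off/N = 1 − N₀/N`. RH-free. [folklore] -/
theorem eventually_offLine_ratio_eq :
    ∀ᶠ T : ℝ in atTop,
      ((∑ ρ ∈ ((zetaZeroBox_finite 0 T).toFinset).filter (fun ρ ↦ ρ.re ≠ 1 / 2), riemannZetaZeroOrder ρ : ℤ) : ℝ) / zetaZeroCount T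
        = 1 - (criticalZeroCount T : ℝ) / zetaZeroCount T := by
  have hN : ∀ᶠ T : ℝ in atTop, 1 ≤ zetaZeroCount T :=
    tendsto_zetaZeroCount_atTop_holds.eventually_ge_atTop 1
  filter_upwards [hN] with T hT
  have hN0 : (zetaZeroCount T : ℝ) ≠ 0 := by exact_mod_cast (Nat.one_le_iff_ne_zero.1 hT)
  have hid := zetaZeroCount_eq_offLineCount_add_criticalZeroCount T
  have hidR : (zetaZeroCount T : ℝ) =
      ((∑ ρ ∈ ((zetaZeroBox_finite 0 T).toFinset).filter (fun ρ ↦ ρ.re ≠ 1 / 2), riemannZetaZeroOrder ρ : ℤ) : ℝ)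
        + (criticalZeroCount T : ℝ) := by
    exact_mod_cast hid
  rw [eq_sub_iff_add_eq, ← add_div, ← hidR, div_self hN0]

/-- SPARSE(o(N)) ⟺ the 100 % hypothesis: `N_off(T)/N(T) → 0 ↔ N₀(T)/N(T) → 1`. RH-free.
[folklore; rh-split theory-2 C18 row H6] -/
theorem offLineDensityZero_iff_onLineDensityOne :
    Tendsto (fun T : ℝ ↦ ((∑ ρ ∈ ((zetaZeroBox_finite 0 T).toFinset).filter (fun ρ ↦ ρ.re ≠ 1 / 2), riemannZetaZeroOrder ρ : ℤ) : ℝ) / zetaZeroCount T) atTop (𝓝 0)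
      ↔ Tendsto (fun T : ℝ ↦ (criticalZeroCount T : ℝ) / zetaZeroCount T) atTop (𝓝 1) := by
  constructor
  · intro h
    have h' : Tendsto (fun T : ℝ ↦ 1 -
        ((∑ ρ ∈ ((zetaZeroBox_finite 0 T).toFinset).filter (fun ρ ↦ ρ.re ≠ 1 / 2), riemannZetaZeroOrder ρ : ℤ) : ℝ) / zetaZeroCount T)
        atTop (𝓝 (1 - 0)) :=
      tendsto_const_nhds.sub h
    rw [sub_zero] at h'
    refine h'.congr' ?_
    filter_upwards [eventually_offLine_ratio_eq] with T hT
    rw [hT]; ring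
  · intro h
    have h' : Tendsto (fun T : ℝ ↦ 1 - (criticalZeroCount T : ℝ) / zetaZeroCount T) atTop (𝓝 (1 - 1)) :=
      tendsto_const_nhds.sub h
    rw [sub_self] at h'
    refine h'.congr' ?_
    filter_upwards [eventually_offLine_ratio_eq] with T hT
    rw [hT]

/-- ROW H6 (CONDITIONAL bookkeeping): the 100 % hypothesis `N₀/N → 1` certifies SPARSE(o(N)); with the fiat complement
«density-zero off-line set ⟹ empty» it gives RH. [new-combination; rh-split theory-2 C18 row H6] -/
theorem rh_of_onLineDensityOne_of_rigid
    (h : Tendsto (fun T : ℝ ↦ (criticalZeroCount T : ℝ) / zetaZeroCount T) atTop (𝓝 1))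
    (hR : Tendsto (fun T : ℝ ↦ ((∑ ρ ∈ ((zetaZeroBox_finite 0 T).toFinset).filter (fun ρ ↦ ρ.re ≠ 1 / 2), riemannZetaZeroOrder ρ : ℤ) : ℝ) / zetaZeroCount T) atTop (𝓝 0) → RiemannHypothesis) :
    RiemannHypothesis :=
  hR (offLineDensityZero_iff_onLineDensityOne.2 h)

/-- BY-PRODUCT (CONDITIONAL-on-PCC; zd-bridge g4's p475996 in `N₀`-currency): Montgomery's pair correlation conjecture
in the tree's RH-free multiset typing implies that 100 % of the zeros lie on the critical line, `N₀(T)/N(T) → 1`.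
[new-combination; rh-split theory-2 C18 row H6] -/
theorem onLineDensityOne_of_pairCorrelation (hP : MontgomeryPairCorrelation) :
    Tendsto (fun T : ℝ ↦ (criticalZeroCount T : ℝ) / zetaZeroCount T) atTop (𝓝 1) :=
  offLineDensityZero_iff_onLineDensityOne.1 (offLine_density_tendsto_zero_of_pairCorrelation hP)

/-! ## Collapse at proved rungs versus the unproved rung DH -/

/-- COLLAPSE at Guth–Maynard's rung: from the PROVED 30/13 zero-density theorem (`zeroDensity_thirty_thirteenths_holds`)
the rigidity complement is RH verbatim. [new-but-trivial; rh-split theory-2 F3(iii)] -/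
theorem rigid_thirtyThirteenths_iff_rh :
    (zeroDensity_thirty_thirteenths → RiemannHypothesis) ↔ RiemannHypothesis :=
  rigid_iff_rh_of_proved zeroDensity_thirty_thirteenths_holds

/-- COLLAPSE at Ingham's rung `N(σ,T) ≪ T^{3(1−σ)/(2−σ)+ε}` (tree `zeroDensity_ingham_holds`).
[new-but-trivial; rh-split theory-2 F3(iii)] -/
theorem rigid_ingham_iff_rh : (zeroDensity_ingham → RiemannHypothesis) ↔ RiemannHypothesis :=
  rigid_iff_rh_of_proved zeroDensity_ingham_holds

/-- COLLAPSE at Huxley's rung (Ivić Thm 11.1 form, tree `Ivic1985_theorem11_1_huxley_holds`).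
[new-but-trivial; rh-split theory-2 F3(iii)] -/
theorem rigid_huxley_iff_rh : (Ivic1985_theorem11_1_huxley → RiemannHypothesis) ↔ RiemannHypothesis :=
  rigid_iff_rh_of_proved Ivic1985_theorem11_1_huxley_holds

/-- Whereas at an UNPROVED rung the complement is only RH-implied: `(DensityHypothesis → RH) ↔ RH ∨ ¬DH`
(likewise for SPARSE(o(N)) and for FOZ). [new-but-trivial; rh-split theory-2 F3(iii)] -/
theorem rigid_densityHypothesis_iff :
    (DensityHypothesis → RiemannHypothesis) ↔ RiemannHypothesis ∨ ¬ DensityHypothesis :=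
  rigid_iff_rh_or_not _

/-! ## Addendum G7c — row H5 (GUE) and PA-3 in plant-world form -/

/-- ROW H5, first half (CONDITIONAL on GUE): the GUE hypothesis at all levels gives Montgomery's pair correlation
(tree `montgomeryPairCorrelation_of_gueHypothesisAt_one`), hence the off-line zeros have density zero (tree p475996).
[new-combination; rh-split theory-2 T2ComplementsExtra §A] -/
theorem offLineDensityZero_of_gue (hG : GUEHypothesis) :
    Tendsto (fun T : ℝ ↦ ((∑ ρ ∈ ((zetaZeroBox_finite 0 T).toFinset).filter (fun ρ ↦ ρ.re ≠ 1 / 2), riemannZetaZeroOrder ρ : ℤ) : ℝ) / zetaZeroCount T) atTop (𝓝 0) :=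
  offLine_density_tendsto_zero_of_pairCorrelation
    (montgomeryPairCorrelation_of_gueHypothesisAt_one (hG 1 le_rfl))

/-- ROW H5 (CONDITIONAL bookkeeping): GUE hypothesis ∧ «density-zero off-line set is empty» ⟹ RH.
[new-combination; rh-split theory-2 T2ComplementsExtra §A] -/
theorem rh_of_gue_of_rigid (hG : GUEHypothesis)
    (hR : Tendsto (fun T : ℝ ↦ ((∑ ρ ∈ ((zetaZeroBox_finite 0 T).toFinset).filter (fun ρ ↦ ρ.re ≠ 1 / 2), riemannZetaZeroOrder ρ : ℤ) : ℝ) / zetaZeroCount T) atTop (𝓝 0) → RiemannHypothesis) :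
    RiemannHypothesis :=
  hR (offLineDensityZero_of_gue hG)

section PlantWorlds

variable {World : Type*} (Sparse NoOff : World → Prop)

/-- PA-3 (plant-world form, pure logic): in a model world `W` with an off-line zero (`¬ NoOff W`), the fiat complement
`Sparse W → NoOff W` HOLDS iff the sparseness conjunct FAILS. [new-but-trivial; rh-split theory-2 T2ComplementsExtra §B] -/
theorem fiatRigid_iff_not_sparse {W : World} (hW : ¬ NoOff W) :
    (Sparse W → NoOff W) ↔ ¬ Sparse W :=
  ⟨fun hB hS ↦ hW (hB hS), fun hnS hS ↦ absurd hS hnS⟩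

/-- COMPLEMENTARY SIGNATURES (plant-world form): in every non-RH world EXACTLY ONE of the two conjuncts of
«Sparse ∧ (Sparse → NoOff)» fails — so a plant-a-zero screen of a fiat rigidity complement measures only the plant's
sparseness class. [new-but-trivial; rh-split theory-2 T2ComplementsExtra §B, ruling PA-3] -/
theorem exactly_one_conjunct_fails {W : World} (hW : ¬ NoOff W) :
    Xor (¬ Sparse W) (¬ (Sparse W → NoOff W)) := by
  by_cases hS : Sparse W
  · exact Or.inr ⟨fun hB ↦ hW (hB hS), fun hnS ↦ hnS hS⟩
  · exact Or.inl ⟨hS, fun hnB ↦ hnB ((fiatRigid_iff_not_sparse Sparse NoOff hW).2 hS)⟩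

/-- Consequently the split «Sparse ∧ (Sparse → NoOff)» fails in every non-RH world (trivially) …
[new-but-trivial; rh-split theory-2 T2ComplementsExtra §B] -/
theorem split_fails_in_every_nonRH_world {W : World} (hW : ¬ NoOff W) :
    ¬ (Sparse W ∧ (Sparse W → NoOff W)) :=
  fun h ↦ hW (h.2 h.1)

/-- … and in RH-worlds the fiat complement holds automatically, so both conjuncts' failure sets are governed by
`Sparse` alone. [new-but-trivial; rh-split theory-2 T2ComplementsExtra §B] -/
theorem fiatRigid_of_noOff {W : World} (hW : NoOff W) : Sparse W → NoOff W :=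
  fun _ ↦ hW

end PlantWorlds

end Summit.RiemannHypothesis.RiemannHypothesis.Theorems.Splittings.SparseRigid

end
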